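import Summits.CriticalPhenomena.PercolationContinuityZ3.Theorems.SahiMasterFamilyStepA
import Summits.CriticalPhenomena.PercolationContinuityZ3.Theorems.SahiMasterFamilySaturation

/-!
# Terminal triples: Lemma (αα) — an N0 coordinate cannot have both minors realised by the section pairs

Companion of `SahiMasterFamilyStepA.lean` (unit `prim-master-conj`; terminal analysis of (T), paper STRUCTURE-PROOF.md
§9 Lemma (αα), verified VERIFICATION-gen3.md).  Setting: increasing events `A, B, C` with no private and no common
coordinate, no saturating coordinate for `A` and `C` (NS, non-triangle), a shared coordinate `e ∈ esupp A ∩ esupp B`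
that is mandatory for neither `A` nor `B` ("N0"), and all contractions at the coordinates of `esupp A ∩ esupp C` in
`Z_3`.

* `lemma_alpha_alpha` — it is impossible that BOTH `e`-minors are realised by the section pairs, i.e. that
  `(A_e, B_e, C) ∈ Z_3` via `(A_e, B_e)` and `(A^e, B^e, C) ∈ Z_3` via `(A^e, B^e)`.
  Proof as in the paper: (1) the configuration `esupp A ∩ esupp C` lies in `C` (downward induction using the Lemma-Z
  side conditions of both minors); (2) for every `s ∈ esupp A ∩ esupp C` the contraction `A^s` does not depend on `e`;
  (3) hence on configurations meeting `esupp A ∩ esupp C` the event `A` ignores `e` and, by the support splitting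
  `F₁ ⊔ F₂` of `esupp A ∩ esupp B ∖ {e}`, all of `esupp A ∩ esupp B`; with NS this contradicts `e ∈ esupp A`.
Everything here is proved; axioms standard. [this work]
-/

noncomputable section

open scoped Classical

namespace Summit.CriticalPhenomena.PercolationContinuityZ3.Theorems

open Finset Function
open Literature.Probability.Percolation (DeterminedBy determinedBy_iff)
open Literature.Probability.LatticeModels.Kahn2022 (Affects)

variable {ι : Type*} [Fintype ι]

/-- **Lemma (αα).** [this work] -/
theorem lemma_alpha_alpha {A B C : Set (Set ι)} (hA : IsUpperSet A) (hB : IsUpperSet B) (hC : IsUpperSet C)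
    (hAC : (esupp A ∩ esupp C).Nonempty)
    (hprivA : esupp A ⊆ esupp B ∪ esupp C) (hprivB : esupp B ⊆ esupp A ∪ esupp C)
    (hprivC : esupp C ⊆ esupp A ∪ esupp B) (hcommon : ∀ i, i ∈ esupp A → i ∈ esupp B → i ∉ esupp C)
    (hNSA : ∀ s ∈ esupp A, ({s} : Set ι) ∉ A) (hNSC : ∀ s ∈ esupp C, ({s} : Set ι) ∉ C)
    {e : ι} (heA : e ∈ esupp A) (heB : e ∈ esupp B)
    (hA0 : Set.univ \ {e} ∈ A) (hB0 : Set.univ \ {e} ∈ B)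
    (hZ0 : ZVia (secAt e false A) (secAt e false B) C) (hZ1 : ZVia (secAt e true A) (secAt e true B) C)
    (hmin : ∀ s ∈ esupp A ∩ esupp C, SuppZeroFlag 3 ![secAt s true A, secAt s true B, secAt s true C]) : False := by
  have heC : e ∉ esupp C := hcommon e heA heB
  set IAB := esupp A ∩ esupp B with hIAB
  set IAC := esupp A ∩ esupp C with hIAC
  set IBC := esupp B ∩ esupp C with hIBC
  have hA0u : IsUpperSet (secAt e false A) := isUpperSet_secAt e false hA
  have hA1u : IsUpperSet (secAt e true A) := isUpperSet_secAt e true hA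
  have hB0u : IsUpperSet (secAt e false B) := isUpperSet_secAt e false hB
  have hB1u : IsUpperSet (secAt e true B) := isUpperSet_secAt e true hB
  have hAne : A.Nonempty := ⟨_, hA0⟩
  have hBne : B.Nonempty := ⟨_, hB0⟩
  have hCne : C.Nonempty := by
    obtain ⟨i, hi⟩ := hAC; exact (nonempty_of_esupp_nonempty ⟨i, (mem_inter.1 hi).2⟩).1
  obtain ⟨dAB0, pa0, pb0⟩ := zVia_pivotal hA0u hB0u hC hZ0
  obtain ⟨dAB1, pa1, pb1⟩ := zVia_pivotal hA1u hB1u hC hZ1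
  -- support bookkeeping
  have esA : esupp A = IAB ∪ IAC := by
    ext f; rw [mem_union, hIAB, hIAC, mem_inter, mem_inter]
    constructor
    · intro hf
      rcases mem_union.1 (hprivA hf) with h | h
      · exact Or.inl ⟨hf, h⟩
      · exact Or.inr ⟨hf, h⟩
    · rintro (⟨h, -⟩ | ⟨h, -⟩) <;> exact h
  have esB : esupp B = IAB ∪ IBC := by
    ext f; rw [mem_union, hIAB, hIBC, mem_inter, mem_inter]
    constructor
    · intro hf
      rcases mem_union.1 (hprivB hf) with h | h
      · exact Or.inl ⟨h, hf⟩
      · exact Or.inr ⟨hf, h⟩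
    · rintro (⟨-, h⟩ | ⟨h, -⟩) <;> exact h
  have esC : esupp C = IAC ∪ IBC := by
    ext f; rw [mem_union, hIAC, hIBC, mem_inter, mem_inter]
    constructor
    · intro hf
      rcases mem_union.1 (hprivC hf) with h | h
      · exact Or.inl ⟨h, hf⟩
      · exact Or.inr ⟨h, hf⟩
    · rintro (⟨-, h⟩ | ⟨-, h⟩) <;> exact h
  have hIAC_B : ∀ s ∈ IAC, s ∉ esupp B := fun s hs h => hcommon s (mem_inter.1 hs).1 h (mem_inter.1 hs).2
  have hIBC_A : ∀ t ∈ IBC, t ∉ esupp A := fun t ht h => hcommon t h (mem_inter.1 ht).1 (mem_inter.1 ht).2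
  have hIAB_C : ∀ f ∈ IAB, f ∉ esupp C := fun f hf => hcommon f (mem_inter.1 hf).1 (mem_inter.1 hf).2
  -- the reference configuration `R = (esupp A ∪ esupp B) ∖ {e}` off `esupp C`: in `A_e`, `A^e`, `B_e`, `B^e`
  set R : Set ι := ↑((IAB).erase e) with hR
  have hRC : R ∩ ↑(esupp C) = ∅ := by
    ext i; simp only [hR, Set.mem_inter_iff, mem_coe, mem_erase, Set.mem_empty_iff_false, iff_false, not_and, and_imp]
    exact fun _ hi hiC => hIAB_C i hi hiC
  -- membership of `R ∪ Y` (Y ⊆ esupp C) in the four sections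
  have memA1 : ∀ Y : Set ι, Y ⊆ ↑(esupp C) → (↑IAC : Set ι) ⊆ Y → R ∪ Y ∈ secAt e true A := by
    intro Y hY hIY
    rw [mem_secAt]; simp only [forceAt, cond_true]
    refine mem_of_esupp_subset hA hAne ?_
    intro f hf
    rw [esA, coe_union] at hf
    rcases hf with hf | hf
    · by_cases hfe : f = e
      · rw [hfe]; exact Set.mem_insert e _
      · exact Set.mem_insert_of_mem e (Or.inl (by rw [hR, mem_coe, mem_erase]; exact ⟨hfe, hf⟩))
    · exact Set.mem_insert_of_mem e (Or.inr (hIY hf))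
  have memA0 : ∀ Y : Set ι, Y ⊆ ↑(esupp C) → (↑IAC : Set ι) ⊆ Y → R ∪ Y ∈ secAt e false A := by
    intro Y hY hIY
    rw [mem_secAt]; simp only [forceAt, cond_false]
    refine (mem_iff_of_inter_esupp_eq hA (ω' := Set.univ \ {e}) ?_).2 hA0
    ext f
    simp only [Set.mem_inter_iff, Set.mem_sdiff, Set.mem_union, Set.mem_singleton_iff, mem_coe, Set.mem_univ, true_and]
    constructor
    · rintro ⟨⟨_, hfe⟩, hfA⟩; exact ⟨hfe, hfA⟩
    · rintro ⟨hfe, hfA⟩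
      refine ⟨⟨?_, hfe⟩, hfA⟩
      rw [esA, mem_union] at hfA
      rcases hfA with hf | hf
      · exact Or.inl (by rw [hR, mem_coe, mem_erase]; exact ⟨hfe, hf⟩)
      · exact Or.inr (hIY hf)
  have memB1 : ∀ Y : Set ι, Y ⊆ ↑(esupp C) → (↑IBC : Set ι) ⊆ Y → R ∪ Y ∈ secAt e true B := by
    intro Y hY hIY
    rw [mem_secAt]; simp only [forceAt, cond_true]
    refine mem_of_esupp_subset hB hBne ?_
    intro f hf
    rw [esB, coe_union] at hf
    rcases hf with hf | hf
    · by_cases hfe : f = e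
      · rw [hfe]; exact Set.mem_insert e _
      · exact Set.mem_insert_of_mem e (Or.inl (by rw [hR, mem_coe, mem_erase]; exact ⟨hfe, hf⟩))
    · exact Set.mem_insert_of_mem e (Or.inr (hIY hf))
  have memB0 : ∀ Y : Set ι, Y ⊆ ↑(esupp C) → (↑IBC : Set ι) ⊆ Y → R ∪ Y ∈ secAt e false B := by
    intro Y hY hIY
    rw [mem_secAt]; simp only [forceAt, cond_false]
    refine (mem_iff_of_inter_esupp_eq hB (ω' := Set.univ \ {e}) ?_).2 hB0
    ext f
    simp only [Set.mem_inter_iff, Set.mem_sdiff, Set.mem_union, Set.mem_singleton_iff, mem_coe, Set.mem_univ, true_and]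
    constructor
    · rintro ⟨⟨_, hfe⟩, hfB⟩; exact ⟨hfe, hfB⟩
    · rintro ⟨hfe, hfB⟩
      refine ⟨⟨?_, hfe⟩, hfB⟩
      rw [esB, mem_union] at hfB
      rcases hfB with hf | hf
      · exact Or.inl (by rw [hR, mem_coe, mem_erase]; exact ⟨hfe, hf⟩)
      · exact Or.inr (hIY hf)
  -- membership in `C` does not see `R`
  have memC : ∀ Y : Set ι, (R ∪ Y ∈ C ↔ Y ∈ C) := by
    intro Y
    refine mem_iff_of_inter_esupp_eq hC ?_
    rw [Set.union_inter_distrib_right, hRC, Set.empty_union]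
  -- Step (1): `IAC ∈ C` and `IBC ∈ C`, by downward induction
  have claimC : ∀ (P Q : Finset ι) (S0 S1 : Set (Set ι)) (E0 E1 : Finset ι), esupp C = P ∪ Q →
      (∀ Y : Set ι, Y ⊆ ↑(esupp C) → (↑P : Set ι) ⊆ Y → R ∪ Y ∈ S0) →
      (∀ Y : Set ι, Y ⊆ ↑(esupp C) → (↑P : Set ι) ⊆ Y → R ∪ Y ∈ S1) →
      (∀ t ∈ E0, ∀ ω ∈ S0, ω ∉ C → insert t ω ∉ C) → (∀ t ∈ E1, ∀ ω ∈ S1, ω ∉ C → insert t ω ∉ C) →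
      (∀ t ∈ Q, t ∈ E0 ∨ t ∈ E1) → (↑P : Set ι) ∈ C := by
    intro P Q S0 S1 E0 E1 hPQ hm0 hm1 hp0 hp1 hsplit
    have step : ∀ σ : Finset ι, σ ⊆ Q → (↑(P ∪ (Q \ σ)) : Set ι) ∈ C := by
      intro σ
      induction σ using Finset.induction_on with
      | empty =>
        intro _
        rw [Finset.sdiff_empty, ← hPQ]
        exact mem_of_esupp_subset hC hCne subset_rfl
      | insert t σ htσ ih =>
        intro hsub
        have htQ : t ∈ Q := hsub (mem_insert_self t σ)
        have hσ : σ ⊆ Q := fun i hi => hsub (mem_insert_of_mem hi)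
        have hprev := ih hσ
        set Y : Set ι := ↑(P ∪ (Q \ insert t σ)) with hYdef
        have heq : (↑(P ∪ (Q \ σ)) : Set ι) = insert t Y := by
          ext i
          simp only [hYdef, mem_coe, mem_union, mem_sdiff, Finset.mem_insert, Set.mem_insert_iff, not_or]
          constructor
          · rintro (hi | ⟨hiQ, hiσ⟩)
            · exact Or.inr (Or.inl hi)
            · by_cases hit : i = t
              · exact Or.inl hit
              · exact Or.inr (Or.inr ⟨hiQ, hit, hiσ⟩)
          · rintro (rfl | hi | ⟨hiQ, -, hiσ⟩)
            · exact Or.inr ⟨htQ, htσ⟩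
            · exact Or.inl hi
            · exact Or.inr ⟨hiQ, hiσ⟩
        rw [heq] at hprev
        by_contra hY
        have hYC : Y ⊆ ↑(esupp C) := by
          intro i hi
          simp only [hYdef, mem_coe, mem_union, mem_sdiff] at hi
          rw [hPQ, mem_coe, mem_union]
          rcases hi with hi | ⟨hi, -⟩
          · exact Or.inl hi
          · exact Or.inr hi
        have hPY : (↑P : Set ι) ⊆ Y := by
          intro i hi; simp only [hYdef, mem_coe, mem_union]; exact Or.inl (mem_coe.1 hi)
        have hRY : R ∪ Y ∉ C := fun h => hY ((memC Y).1 h)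
        have hRY' : insert t (R ∪ Y) ∈ C := by rw [← Set.union_insert]; exact (memC _).2 hprev
        rcases hsplit t htQ with ht | ht
        · exact hp0 t ht _ (hm0 Y hYC hPY) hRY hRY'
        · exact hp1 t ht _ (hm1 Y hYC hPY) hRY hRY'
    have := step Q subset_rfl
    rwa [Finset.sdiff_self, Finset.union_empty] at this
  have splitB : ∀ t ∈ IBC, t ∈ esupp (secAt e false B) ∨ t ∈ esupp (secAt e true B) := fun t ht =>
    mem_esupp_secAt_or (mem_inter.1 ht).1 (fun hte => heC (hte ▸ (mem_inter.1 ht).2))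
  have splitA : ∀ s ∈ IAC, s ∈ esupp (secAt e false A) ∨ s ∈ esupp (secAt e true A) := fun s hs =>
    mem_esupp_secAt_or (mem_inter.1 hs).1 (fun hse => heC (hse ▸ (mem_inter.1 hs).2))
  have hIACmem : (↑IAC : Set ι) ∈ C :=
    claimC IAC IBC _ _ _ _ esC memA0 memA1 pa0 pa1 splitB
  have hIBCmem : (↑IBC : Set ι) ∈ C :=
    claimC IBC IAC _ _ _ _ (by rw [esC, union_comm]) memB0 memB1 pb0 pb1 splitA
  -- Step (2): for `s ∈ IAC`, the contraction `A^s` does not depend on `e`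
  have step2 : ∀ s ∈ IAC, ¬ Affects (secAt s true A) e := by
    intro s hs heAs
    have hsC := (mem_inter.1 hs).2
    have hsB : s ∉ esupp B := hIAC_B s hs
    have hse : s ≠ e := fun hse => heC (hse ▸ hsC)
    have hm := hmin s hs
    rw [secAt_eq_self_of_not_affects hB (fun h => hsB (mem_esupp.2 h)) true] at hm
    have hAs : IsUpperSet (secAt s true A) := isUpperSet_secAt s true hA
    have hCs : IsUpperSet (secAt s true C) := isUpperSet_secAt s true hC
    have heAs' : e ∈ esupp (secAt s true A) := mem_esupp.2 heAs
    -- `IBC ∈ C^s` and `IAC ∖ s ∈ C^s`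
    have hIBCs : (↑IBC : Set ι) ∈ secAt s true C := by
      rw [mem_secAt]; simp only [forceAt, cond_true]
      exact hC (Set.subset_insert s _) hIBCmem
    have hIACs : (↑(IAC.erase s) : Set ι) ∈ secAt s true C := by
      rw [mem_secAt]; simp only [forceAt, cond_true]
      rwa [coe_erase, Set.insert_sdiff_singleton, Set.insert_eq_of_mem (mem_coe.2 hs)]
    rcases (suppZeroFlag_three_iff_zVia _ _ _).1 hm with h | h | h
    · -- via (B, C^s): `C^s` ignores `IBC`, so `∅ ∈ C^s`, i.e. `{s} ∈ C`
      obtain ⟨dBCs, -, -⟩ := zVia_pivotal hB hCs hAs h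
      have h0 : (∅ : Set ι) ∈ secAt s true C := by
        refine (mem_iff_of_inter_esupp_eq hCs (ω := ∅) (ω' := ↑IBC) ?_).2 hIBCs
        ext i
        simp only [Set.empty_inter, Set.mem_empty_iff_false, Set.mem_inter_iff, mem_coe, false_iff, not_and]
        intro hiBC hiCs
        exact Finset.disjoint_left.1 dBCs (mem_inter.1 hiBC).1 hiCs
      rw [mem_secAt] at h0; simp only [forceAt, cond_true, insert_empty_eq] at h0
      exact hNSC s hsC h0
    · -- via (A^s, C^s), third B: a pivotal configuration for `B` at `e` inside `C^s`
      obtain ⟨-, -, p2⟩ := zVia_pivotal hAs hCs hB h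
      obtain ⟨Z, hZB, heZ⟩ := mem_esupp.1 heB
      -- fill `Z` with `IAC ∖ s`, which `B` ignores
      have hagree : ∀ η : Set ι, (η ∪ ↑(IAC.erase s)) ∩ ↑(esupp B) = η ∩ ↑(esupp B) := by
        intro η; ext i
        simp only [Set.mem_inter_iff, Set.mem_union, mem_coe, mem_erase]
        constructor
        · rintro ⟨hi | ⟨-, hiAC⟩, hiB⟩
          · exact ⟨hi, hiB⟩
          · exact absurd hiB (hIAC_B i hiAC)
        · rintro ⟨hi, hiB⟩; exact ⟨Or.inl hi, hiB⟩
      have h1 : Z ∪ ↑(IAC.erase s) ∉ B := fun h' => hZB ((mem_iff_of_inter_esupp_eq hB (hagree Z)).1 h')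
      have h2 : insert e (Z ∪ ↑(IAC.erase s)) ∈ B := by
        rw [← Set.insert_union]
        exact (mem_iff_of_inter_esupp_eq hB (hagree (insert e Z))).2 heZ
      exact p2 e heAs' _ (hCs Set.subset_union_right hIACs) h1 h2
    · -- via (A^s, B): both depend on `e`
      exact Finset.disjoint_left.1 (zVia_pivotal hAs hB hCs h).1 heAs' heB
  -- Step (3a): on configurations meeting `IAC`, membership in `A` ignores `e`
  have step3a : ∀ ω : Set ι, (∃ s ∈ IAC, s ∈ ω) → (insert e ω ∈ A ↔ ω ∈ A) := by
    rintro ω ⟨s, hs, hsω⟩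
    rw [← mem_secAt_true_iff_of_mem (Set.mem_insert_of_mem e hsω), ← mem_secAt_true_iff_of_mem hsω]
    exact insert_mem_iff_of_not_affects (isUpperSet_secAt s true hA) (step2 s hs) ω
  -- Step (3b): … and ignores every `f ∈ IAB`
  have step3b : ∀ f ∈ IAB, ∀ ω : Set ι, (∃ s ∈ IAC, s ∈ ω) → (insert f ω ∈ A ↔ ω ∈ A) := by
    intro f hf ω hω
    by_cases hfe : f = e
    · rw [hfe]; exact step3a ω hω
    have hfB : f ∈ esupp B := (mem_inter.1 hf).2
    have hωf : ∃ s ∈ IAC, s ∈ insert f ω := by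
      obtain ⟨s, hs, hsω⟩ := hω; exact ⟨s, hs, Set.mem_insert_of_mem f hsω⟩
    -- `f` cannot affect both `A_e` and `A^e`
    have hnot : ¬ (f ∈ esupp (secAt e false A) ∧ f ∈ esupp (secAt e true A)) := by
      rintro ⟨h0, h1⟩
      rcases mem_esupp_secAt_or hfB hfe with hb | hb
      · exact Finset.disjoint_left.1 dAB0 h0 hb
      · exact Finset.disjoint_left.1 dAB1 h1 hb
    by_cases hf1 : f ∈ esupp (secAt e true A)
    · -- then `f ∉ esupp A_e`: compare through `A_e`
      have hf0 : ¬ Affects (secAt e false A) f := fun h => hnot ⟨mem_esupp.2 h, hf1⟩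
      -- `η ∈ A ↔ η ∖ {e} ∈ A` for `η` meeting `IAC`
      have viaA0 : ∀ η : Set ι, (∃ s ∈ IAC, s ∈ η) → (η ∈ A ↔ η ∈ secAt e false A) := by
        intro η hη
        rw [mem_secAt]; simp only [forceAt, cond_false]
        by_cases heη : e ∈ η
        · have := step3a (η \ {e}) (by
            obtain ⟨s, hs, hsη⟩ := hη
            exact ⟨s, hs, ⟨hsη, fun h => heC ((Set.mem_singleton_iff.1 h) ▸ (mem_inter.1 hs).2)⟩⟩)
          rw [Set.insert_sdiff_singleton, Set.insert_eq_of_mem heη] at this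
          exact this
        · rw [Set.sdiff_singleton_eq_self heη]
      rw [viaA0 _ hωf, viaA0 _ hω]
      exact insert_mem_iff_of_not_affects hA0u hf0 ω
    · -- `f ∉ esupp A^e`: compare through `A^e`
      have hf1' : ¬ Affects (secAt e true A) f := fun h => hf1 (mem_esupp.2 h)
      have viaA1 : ∀ η : Set ι, (∃ s ∈ IAC, s ∈ η) → (η ∈ A ↔ η ∈ secAt e true A) := by
        intro η hη
        rw [mem_secAt]; simp only [forceAt, cond_true]
        exact (step3a η hη).symm
      rw [viaA1 _ hωf, viaA1 _ hω]
      exact insert_mem_iff_of_not_affects hA1u hf1' ω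
  -- Step (3c): removing all of `IAB` keeps membership (for configurations meeting `IAC`)
  have step3c : ∀ ω : Set ι, (∃ s ∈ IAC, s ∈ ω) → ω ∈ A → ω \ ↑IAB ∈ A := by
    intro ω hω hωA
    have gen : ∀ σ : Finset ι, σ ⊆ IAB → ω \ ↑σ ∈ A := by
      intro σ
      induction σ using Finset.induction_on with
      | empty => intro _; simpa using hωA
      | insert f σ hfσ ih =>
        intro hsub
        have hfAB : f ∈ IAB := hsub (mem_insert_self f σ)
        have hprev := ih (fun i hi => hsub (mem_insert_of_mem hi))
        have hmeet : ∃ s ∈ IAC, s ∈ ω \ ↑(insert f σ) := by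
          obtain ⟨s, hs, hsω⟩ := hω
          refine ⟨s, hs, hsω, fun h => ?_⟩
          have hsAB : s ∈ IAB := hsub (mem_coe.1 h)
          exact hIAB_C s hsAB (mem_inter.1 hs).2
        by_cases hfω : f ∈ ω \ ↑σ
        · have heq : ω \ ↑σ = insert f (ω \ ↑(insert f σ)) := by
            ext i
            simp only [Set.mem_sdiff, mem_coe, Finset.mem_insert, Set.mem_insert_iff, not_or]
            constructor
            · rintro ⟨hi, hiσ⟩
              by_cases hif : i = f
              · exact Or.inl hif
              · exact Or.inr ⟨hi, hif, hiσ⟩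
            · rintro (rfl | ⟨hi, -, hiσ⟩)
              · exact hfω
              · exact ⟨hi, hiσ⟩
          rw [heq, step3b f hfAB _ hmeet] at hprev
          exact hprev
        · have heq : ω \ ↑(insert f σ) = ω \ ↑σ := by
            ext i
            simp only [Set.mem_sdiff, mem_coe, Finset.mem_insert, not_or]
            constructor
            · rintro ⟨hi, -, hiσ⟩; exact ⟨hi, hiσ⟩
            · rintro ⟨hi, hiσ⟩
              exact ⟨hi, fun hif => hfω ⟨hif ▸ hi, hif ▸ hiσ⟩, hiσ⟩
          rw [heq]; exact hprev
    exact gen IAB subset_rfl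
  -- Step (3d): contradiction with `e ∈ esupp A`
  obtain ⟨Z, hZA, heZ⟩ := mem_esupp.1 heA
  obtain ⟨s, hs⟩ := hAC
  by_cases hmeet : ∃ s ∈ IAC, s ∈ Z
  · exact hZA ((step3a Z hmeet).1 heZ)
  · -- `W = Z ∪ {e, s} ∈ A` meets `IAC`; strip `IAB`: what is left has trace `{s}` on `esupp A`
    have hW : insert s (insert e Z) ∈ A := hA (Set.subset_insert s _) heZ
    have hW' := step3c _ ⟨s, hs, Set.mem_insert s _⟩ hW
    refine hNSA s (mem_inter.1 hs).1 ((mem_iff_of_inter_esupp_eq hA (ω := {s}) ?_).2 hW')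
    ext i
    simp only [Set.mem_inter_iff, Set.mem_singleton_iff, mem_coe, Set.mem_sdiff, Set.mem_insert_iff]
    constructor
    · rintro ⟨rfl, hiA⟩
      exact ⟨⟨Or.inl rfl, fun h => hIAC_B i (by exact hs) (mem_inter.1 h).2⟩, hiA⟩
    · rintro ⟨⟨hi, hiAB⟩, hiA⟩
      rcases hi with rfl | rfl | hiZ
      · exact ⟨rfl, hiA⟩
      · exact absurd (mem_inter.2 ⟨heA, heB⟩) hiAB
      · -- `i ∈ Z ∩ esupp A`, not in `IAB`, hence in `IAC`: contradicts `hmeet`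
        exfalso
        rw [esA, mem_union] at hiA
        rcases hiA with h | h
        · exact hiAB h
        · exact hmeet ⟨i, h, hiZ⟩

end Summit.CriticalPhenomena.PercolationContinuityZ3.Theorems
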